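import Summits.QuantumFields.YangMills.Theorems.CurvatureBoostCovariance.Negative.VacuumSharp
import Literature.MathematicalPhysics.QuantumLattice.GaugeGroupsProofs

/-!
# `CurvatureBoostCovariance` — negative-side support III: invariance as equality of functionals on `𝓢` is FALSE

Support file for crux `stmt-QuantumFields-9663`, extracted from `Cruxes/CurvatureBoostCovariance/Disproof.lean` (§4):
`not_curvatureBoostCovarianceOnAllTests` — the crux with `IsOffDiagonal F →` dropped from its conclusion fails for
`G = SU(2)`, the fundamental representation, the zero scheme and `S₁ = S♯`: the half-turn `diag(-1,-1,1,1)` of the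
`(x₀,x₁)`-plane (determinant 1, fixes `e₂, e₃`) moves the bump at `(e₁,e₁,e₁)` to `(-e₁,-e₁,-e₁)`.
Message to provers: prove invariance ON `⁰𝒮`; nothing pins a tied family at coincident points.
-/

noncomputable section

open scoped SchwartzMap ComplexConjugate
open MeasureTheory Filter Topology Complex
open Literature.MathematicalPhysics.AQFT Literature.MathematicalPhysics.QuantumLattice
open Literature.MathematicalPhysics.QuantumFieldTheory

namespace Summit.QuantumFields.YangMills.Theorems.CurvatureBoostCovariance.Negative

/-! ### The half-turn of the `(x₀,x₁)`-plane and the bump at `(e₁,e₁,e₁)` -/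

/-- Reflection in the hyperplane orthogonal to the axis `eᵢ`. -/
def axisReflection (i : Fin 4) : (EuclideanSpace ℝ (Fin 4)) ≃ₗᵢ[ℝ] (EuclideanSpace ℝ (Fin 4)) :=
  (ℝ ∙ (EuclideanSpace.single i (1 : ℝ) : (EuclideanSpace ℝ (Fin 4))))ᗮ.reflection

/-- The half-turn `diag(-1,-1,1,1)` = reflection along `e₀` then along `e₁`. -/
def halfTurn : (EuclideanSpace ℝ (Fin 4)) ≃ₗᵢ[ℝ] (EuclideanSpace ℝ (Fin 4)) := (axisReflection 0).trans (axisReflection 1)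

/-- The coordinate vectors are non-zero. -/
theorem single_ne_zero (i : Fin 4) : (EuclideanSpace.single i (1 : ℝ) : (EuclideanSpace ℝ (Fin 4))) ≠ 0 := by
  intro h
  have := congrArg (fun v : (EuclideanSpace ℝ (Fin 4)) => v i) h
  simp at this

/-- An axis reflection has determinant `-1`. -/
theorem det_axisReflection (i : Fin 4) :
    LinearMap.det ((axisReflection i).toLinearEquiv : (EuclideanSpace ℝ (Fin 4)) →ₗ[ℝ] (EuclideanSpace ℝ (Fin 4))) = -1 := by
  have h := ((ℝ ∙ (EuclideanSpace.single i (1 : ℝ) : (EuclideanSpace ℝ (Fin 4))))ᗮ).det_reflection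
  rw [Submodule.orthogonal_orthogonal, finrank_span_singleton (single_ne_zero i), pow_one] at h
  exact h

/-- Determinants multiply under composition of isometries. -/
theorem det_trans (A B : (EuclideanSpace ℝ (Fin 4)) ≃ₗᵢ[ℝ] (EuclideanSpace ℝ (Fin 4))) :
    LinearMap.det ((A.trans B).toLinearEquiv : (EuclideanSpace ℝ (Fin 4)) →ₗ[ℝ] (EuclideanSpace ℝ (Fin 4))) =
      LinearMap.det (B.toLinearEquiv : (EuclideanSpace ℝ (Fin 4)) →ₗ[ℝ] (EuclideanSpace ℝ (Fin 4))) * LinearMap.det (A.toLinearEquiv : (EuclideanSpace ℝ (Fin 4)) →ₗ[ℝ] (EuclideanSpace ℝ (Fin 4))) := by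
  rw [← LinearMap.det_comp]
  rfl

/-- The half-turn has determinant `1`. -/
theorem det_halfTurn : LinearMap.det (halfTurn.toLinearEquiv : (EuclideanSpace ℝ (Fin 4)) →ₗ[ℝ] (EuclideanSpace ℝ (Fin 4))) = 1 := by
  rw [halfTurn, det_trans, det_axisReflection, det_axisReflection]
  norm_num

/-- Distinct coordinate vectors are orthogonal. -/
theorem single_mem_orthogonal {i j : Fin 4} (hij : i ≠ j) :
    (EuclideanSpace.single j (1 : ℝ) : (EuclideanSpace ℝ (Fin 4))) ∈ (ℝ ∙ (EuclideanSpace.single i (1 : ℝ) : (EuclideanSpace ℝ (Fin 4))))ᗮ := by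
  rw [Submodule.mem_orthogonal_singleton_iff_inner_right, EuclideanSpace.inner_single_left]
  simp [hij.symm]

/-- An axis reflection fixes the other coordinate vectors. -/
theorem axisReflection_single_of_ne {i j : Fin 4} (hij : i ≠ j) :
    axisReflection i (EuclideanSpace.single j 1) = EuclideanSpace.single j 1 :=
  Submodule.reflection_mem_subspace_eq_self (single_mem_orthogonal hij)

/-- An axis reflection negates its own coordinate vector. -/
theorem axisReflection_single_self (i : Fin 4) :
    axisReflection i (EuclideanSpace.single i 1) = -EuclideanSpace.single i 1 :=
  Submodule.reflection_orthogonalComplement_singleton_eq_neg _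

/-- The half-turn fixes `e₂`. -/
theorem halfTurn_single_two : halfTurn (EuclideanSpace.single 2 1) = EuclideanSpace.single 2 1 := by
  show axisReflection 1 (axisReflection 0 (EuclideanSpace.single 2 1)) = _
  rw [axisReflection_single_of_ne (by decide), axisReflection_single_of_ne (by decide)]

/-- The half-turn fixes `e₃`. -/
theorem halfTurn_single_three : halfTurn (EuclideanSpace.single 3 1) = EuclideanSpace.single 3 1 := by
  show axisReflection 1 (axisReflection 0 (EuclideanSpace.single 3 1)) = _
  rw [axisReflection_single_of_ne (by decide), axisReflection_single_of_ne (by decide)]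

/-- The half-turn negates `e₁`. -/
theorem halfTurn_e1 : halfTurn e1 = -e1 := by
  show axisReflection 1 (axisReflection 0 (EuclideanSpace.single 1 1)) = -EuclideanSpace.single 1 1
  rw [axisReflection_single_of_ne (by decide), axisReflection_single_self]

/-- The inverse half-turn negates `e₁`. -/
theorem halfTurn_symm_e1 : halfTurn.symm e1 = -e1 := by
  have h : halfTurn (-e1) = e1 := by rw [map_neg, halfTurn_e1, neg_neg]
  calc halfTurn.symm e1 = halfTurn.symm (halfTurn (-e1)) := by rw [h]
    _ = -e1 := halfTurn.symm_apply_apply _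

/-- A test function of degree 3 that is `1` at `(e₁,e₁,e₁)` and `0` at `(-e₁,-e₁,-e₁)`
(a smooth bump of outer radius `1` in the `sup`-distance; the two configurations are `2` apart). -/
theorem exists_bump_three :
    ∃ F : 𝓢((Fin 3 → (EuclideanSpace ℝ (Fin 4))), ℂ), F (fun _ => e1) = 1 ∧ F (fun _ => -e1) = 0 := by
  let c : Fin 3 → (EuclideanSpace ℝ (Fin 4)) := fun _ => e1
  let f : ContDiffBump c := ⟨1 / 2, 1, by norm_num, by norm_num⟩
  have hcs : HasCompactSupport fun y => ((f y : ℝ) : ℂ) := f.hasCompactSupport.comp_left Complex.ofReal_zero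
  have hcd : ContDiff ℝ ((⊤ : ℕ∞) : WithTop ℕ∞) fun y => ((f y : ℝ) : ℂ) :=
    Complex.ofRealCLM.contDiff.comp f.contDiff
  refine ⟨hcs.toSchwartzMap hcd, ?_, ?_⟩
  · show ((f c : ℝ) : ℂ) = 1
    rw [f.one_of_mem_closedBall (Metric.mem_closedBall_self (by norm_num))]
    simp
  · show ((f (fun _ => -e1) : ℝ) : ℂ) = 0
    have hdist : dist (fun _ : Fin 3 => -e1) c = 2 := by
      show dist (fun _ : Fin 3 => -e1) (fun _ : Fin 3 => e1) = 2
      rw [dist_pi_const, dist_eq_norm, show (-e1 - e1 : (EuclideanSpace ℝ (Fin 4))) = (-2 : ℝ) • e1 by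
        rw [neg_smul, two_smul, neg_add, sub_eq_add_neg], norm_smul, e1, PiLp.norm_single]
      norm_num
    rw [f.zero_of_le_dist (by rw [hdist]; norm_num)]
    simp

/-- **§4. THE NATURAL STRENGTHENING IS FALSE**: with the conclusion stated on ALL test
functions (not only on `⁰𝒮`) the crux fails — `G = SU(2)`, `r` = fundamental representation,
the zero scheme, `S₁ = S♯`, the half-turn of the `(x₀,x₁)`-plane and the bump at `(e₁,e₁,e₁)`:
`S♯₃(bump ∘ halfTurn⁻¹) = bump(-e₁,-e₁,-e₁) = 0 ≠ 1 = S♯₃(bump)`. -/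
theorem not_curvatureBoostCovarianceOnAllTests : ¬ CurvatureBoostCovarianceOnAllTests := by
  intro h
  have hG : IsCompactSimpleLieGroup (Matrix.specialUnitaryGroup (Fin 2) ℂ) :=
    isCompactSimpleLieGroup_specialUnitaryGroup isSimpleCompactGroup_specialUnitaryGroup_holds le_rfl
  letI : MeasurableSpace (Matrix.specialUnitaryGroup (Fin 2) ℂ) := borel _
  haveI : BorelSpace (Matrix.specialUnitaryGroup (Fin 2) ℂ) := ⟨rfl⟩
  let r : LatticeRep (Matrix.specialUnitaryGroup (Fin 2) ℂ) :=
    ⟨2, fundamentalRep (Fin 2), continuous_fundamentalRep _, fundamentalRep_injective _,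
      fundamentalRep_mem_unitaryGroup⟩
  obtain ⟨hW, h8, hC, -⟩ := hypotheses_sharp r
  have key := h (Matrix.specialUnitaryGroup (Fin 2) ℂ) hG r (SpeciesScheme.zero _) sharp hW h8 hC
    halfTurn det_halfTurn halfTurn_single_two halfTurn_single_three 3
  obtain ⟨F, hF1, hF0⟩ := exists_bump_three
  have h1 := key F
  rw [sharp_three_apply, sharp_three_apply, linActMulti_apply] at h1
  simp only [halfTurn_symm_e1] at h1
  rw [hF0, hF1] at h1
  exact zero_ne_one h1



end Summit.QuantumFields.YangMills.Theorems.CurvatureBoostCovariance.Negative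

end
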